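import Mathlib
import HarnessLib
import Literature.Computability.AlgebraicComplexity.LaserMethodValues

/-!
# OutsiderSandwich — the blocks of `cw₂ ⊗ cw₂` under the merged blocking (decomp-mm lens-4, g18)

Route-independent half of the kernel of node g18 of the lineage `decomp-mm-lens-4` on
`route-MatrixMultiplication-OutsiderSandwich` (the proof of item 28195 `SquaredLaserPacking` is
completed in `Theorems/OutsiderSandwichSquaredLaserPacking.lean`).  This file imports no route file.

Coppersmith–Winograd's merged blocking of the square `cw₂ ⊗ cw₂` (CW90 §7 with `q = 2`) labels a
word `v : Fin 2 → Fin 3` by its number of zero letters (`zc`); the block support is the tight set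
`S = {(i,j,l) : i + j + l = 2}` (`mergedSupport`, labels `3i − 2`, `cwSq_support`, `lab_tight`).
The three PURE blocks `(2,0,0), (0,2,0), (0,0,2)` are `x₀₀ y_v z_v`, `x_v y₀₀ z_v`, `x_v y_v z₀₀`
(`v ∈ {1,2}²`; `blk_pure₁₂₃`), the three COUPLED blocks `(0,1,1), (1,0,1), (1,1,0)` are the
tensors `C₁, C₂, C₃` of `Theorems/OutsiderSandwichCoupling.lean` (restated verbatim here as
`cpl₁₂₃`, `cplTensor := C₁ ⊠ C₂ ⊠ C₃`, to keep this file route-independent; `blk_coupled₁₂₃`).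

Main result (`laserBlock_restrictsTo`): for the SORTED label word `word N` of the power
`(cw₂ ⊗ cw₂)^{⊗9N}` — `N` units of nine coordinates, each unit carrying the three pure blocks once
and each coupled block twice (`pattern`) — the laser block `t^{⊗9N}(word N)` restricts to
`⟨2,2,2⟩^{⊠2N} ⊠ C^{⊠2N}`; indeed the latter IS the zero-out of the former along the explicit index
embeddings `embX, embY, embZ` (`laserBlock_emb`, one `tensorRestrictsTo_precomp`): per unit, the
product of the three pure blocks at the words built from two `⟨2,2,2⟩`-index triples equals the
product of the two `⟨2,2,2⟩` entries (`unit_identity`).  Also `letterCount (word N) = N · cnt`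
(`letterCount_word`), the joint type used by the counting half.

References: [CoppersmithWinograd1990, §6–§7]; [BurgisserClausenShokrollahi1997, Prop. 15.30,
(15.32)]; [LeGall2014, Appendix A.3]; [Blaser2013, Def. 7.2].
-/

noncomputable section

open scoped BigOperators
open Literature.Computability.AlgebraicComplexity

namespace Summit.MatrixMultiplication.MatrixMultiplication.Theorems.OutsiderSandwichSquaredLaserBlocks

/-! ## 1. The merged blocking of `cw₂ ⊗ cw₂` and its tight support -/

/-- The square `cw₂ ⊗ cw₂` as a tensor power (the kernel's `OutsiderSandwichCoupling.cwSq`). -/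
abbrev cwSq : (Fin 2 → Fin 3) → (Fin 2 → Fin 3) → (Fin 2 → Fin 3) → ℂ :=
  kroneckerPow (cwTensor ℂ 2) 2

/-- Merged index `1`: the pairs with exactly one nonzero coordinate (verbatim the kernel's
`OutsiderSandwichCoupling.mergedOne` and the route item's table). -/
def mOne : Fin 4 → Fin 2 → Fin 3 := ![![0, 1], ![0, 2], ![1, 0], ![2, 0]]

/-- Merged index `2`: both coordinates nonzero (verbatim the kernel's `mergedTwo`). -/
def mTwo : Fin 4 → Fin 2 → Fin 3 := ![![1, 1], ![1, 2], ![2, 1], ![2, 2]]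

/-- The coupled block `C₁ = T^{[211]}` (verbatim the kernel's `coupling₁`). -/
def cpl₁ : Fin 4 → Fin 4 → Fin 4 → ℂ := fun a b c => cwSq (mTwo a) (mOne b) (mOne c)

/-- The coupled block `C₂ = T^{[121]}` (verbatim the kernel's `coupling₂`). -/
def cpl₂ : Fin 4 → Fin 4 → Fin 4 → ℂ := fun a b c => cwSq (mOne a) (mTwo b) (mOne c)

/-- The coupled block `C₃ = T^{[112]}` (verbatim the kernel's `coupling₃`). -/
def cpl₃ : Fin 4 → Fin 4 → Fin 4 → ℂ := fun a b c => cwSq (mOne a) (mOne b) (mTwo c)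

/-- The coupling tensor `C = C₁ ⊠ C₂ ⊠ C₃` (verbatim the kernel's `couplingTensor`). -/
def cplTensor : (Fin 4 × Fin 4) × Fin 4 → (Fin 4 × Fin 4) × Fin 4 → (Fin 4 × Fin 4) × Fin 4 → ℂ :=
  kroneckerTensor (kroneckerTensor cpl₁ cpl₂) cpl₃

/-- Zero-count label of a pair of letters: `0` = both nonzero, `1` = exactly one zero, `2` = both zero. -/
def zcPair (x y : Fin 3) : Fin 3 :=
  if x = 0 then (if y = 0 then 2 else 1) else (if y = 0 then 1 else 0)

/-- The merged blocking of `cw₂ ⊗ cw₂` (Coppersmith–Winograd 1990, §7): a word is labelled by its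
number of zero letters. -/
def zc (v : Fin 2 → Fin 3) : Fin 3 := zcPair (v 0) (v 1)

/-- The merged support `S = {(i,j,l) : i + j + l = 2}`. -/
def mergedSupport : Finset (Fin 3 × Fin 3 × Fin 3) :=
  Finset.univ.filter fun s => s.1.val + s.2.1.val + s.2.2.val = 2

/-- The six block triples of the merged support. -/
theorem mergedSupport_eq : mergedSupport =
    {((2 : Fin 3), (0 : Fin 3), (0 : Fin 3)), (0, 2, 0), (0, 0, 2), (0, 1, 1), (1, 0, 1), (1, 1, 0)} := by
  decide

/-- The support of `cw₂`. -/
theorem cwTensor_ne_zero {i j k : Fin 3} (h : cwTensor ℂ 2 i j k ≠ 0) :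
    (i = 0 ∧ j = k ∧ j ≠ 0) ∨ (j = 0 ∧ i = k ∧ i ≠ 0) ∨ (k = 0 ∧ i = j ∧ i ≠ 0) := by
  rw [cwTensor_apply] at h
  by_contra hn
  exact h (if_neg hn)

/-- Entries of the square. -/
theorem cwSq_apply (a b c : Fin 2 → Fin 3) :
    cwSq a b c = cwTensor ℂ 2 (a 0) (b 0) (c 0) * cwTensor ℂ 2 (a 1) (b 1) (c 1) := by
  simp [kroneckerPow_apply, Fin.prod_univ_two]

/-- The block support of `cw₂ ⊗ cw₂` under the merged blocking is `S`. -/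
theorem cwSq_support (a b c : Fin 2 → Fin 3) (h : cwSq a b c ≠ 0) :
    (zc a, zc b, zc c) ∈ mergedSupport := by
  rw [cwSq_apply] at h
  have h0 := cwTensor_ne_zero (left_ne_zero_of_mul h)
  have h1 := cwTensor_ne_zero (right_ne_zero_of_mul h)
  unfold zc
  revert h0 h1
  generalize a 0 = a0, a 1 = a1, b 0 = b0, b 1 = b1, c 0 = c0, c 1 = c1
  revert a0 a1 b0 b1 c0 c1
  decide

/-- Tight labels `i ↦ 3i − 2` (one coordinate). -/
def lab (i : Fin 3) (_ : Fin 1) : ℤ := 3 * (i : ℤ) - 2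

/-- The labelling is injective. -/
theorem lab_injective : Function.Injective lab := by
  intro i j h
  have := congrFun h 0
  simp only [lab] at this
  omega

/-- The labels are bounded by `4`. -/
theorem lab_abs (i : Fin 3) (k : Fin 1) : |lab i k| ≤ ((4 : ℕ) : ℤ) := by
  unfold lab; have := i.isLt; rw [abs_le]; push_cast; omega

/-- `S` is tight for the labels: `α + β + γ = 3(i + j + l) − 6 = 0` on `S`. -/
theorem lab_tight : ∀ s ∈ mergedSupport, ∀ k, lab s.1 k + lab s.2.1 k + lab s.2.2 k = 0 := by
  intro s hs k
  simp only [mergedSupport, Finset.mem_filter, Finset.mem_univ, true_and] at hs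
  simp only [lab]
  omega

/-! ## 2. The blocks: three pure blocks containing `⟨2,2,2⟩^{⊠2}`, three coupled blocks `C₁, C₂, C₃` -/

/-- The block `(i,j,l)` of `cw₂ ⊗ cw₂` (zero-out to the words with labels `i, j, l`). -/
def blk (s : Fin 3 × Fin 3 × Fin 3) : (Fin 2 → Fin 3) → (Fin 2 → Fin 3) → (Fin 2 → Fin 3) → ℂ :=
  partSubtensor zc zc zc cwSq {s.1} {s.2.1} {s.2.2}

/-- A word with both letters nonzero, encoding two bits. -/
def enc (i j : Fin 2) : Fin 2 → Fin 3 := ![i.succ, j.succ]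

/-- The word `00`. -/
def w00 : Fin 2 → Fin 3 := fun _ => 0

/-- `enc` words have no zero letter. -/
@[simp] theorem zc_enc (i j : Fin 2) : zc (enc i j) = 0 := by
  simp [zc, zcPair, enc, Fin.succ_ne_zero]

/-- `00` has two zero letters. -/
@[simp] theorem zc_w00 : zc w00 = 2 := by simp [zc, zcPair, w00]

/-- Merged index `2` has no zero letter. -/
@[simp] theorem zc_mTwo (p : Fin 4) : zc (mTwo p) = 0 := by
  fin_cases p <;> rfl

/-- Merged index `1` has one zero letter. -/
@[simp] theorem zc_mOne (p : Fin 4) : zc (mOne p) = 1 := by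
  fin_cases p <;> rfl

/-- The pure block `(2,0,0) = x₀₀ ⊗ ∑_v y_v ⊗ z_v`: entry `[y = z]`. -/
@[simp] theorem blk_pure₁ (i j i' j' : Fin 2) :
    blk (2, 0, 0) w00 (enc i j) (enc i' j') = (if i = i' then 1 else 0) * (if j = j' then 1 else 0) := by
  rw [blk, partSubtensor_apply, if_pos (by simp), cwSq_apply]
  simp [enc, w00, cwTensor_apply, Fin.succ_ne_zero]

/-- The pure block `(0,2,0)`: entry `[x = z]`. -/
@[simp] theorem blk_pure₂ (i j i' j' : Fin 2) :
    blk (0, 2, 0) (enc i j) w00 (enc i' j') = (if i = i' then 1 else 0) * (if j = j' then 1 else 0) := by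
  rw [blk, partSubtensor_apply, if_pos (by simp), cwSq_apply]
  simp [enc, w00, cwTensor_apply, Fin.succ_ne_zero]

/-- The pure block `(0,0,2)`: entry `[x = y]`. -/
@[simp] theorem blk_pure₃ (i j i' j' : Fin 2) :
    blk (0, 0, 2) (enc i j) (enc i' j') w00 = (if i = i' then 1 else 0) * (if j = j' then 1 else 0) := by
  rw [blk, partSubtensor_apply, if_pos (by simp), cwSq_apply]
  simp [enc, w00, cwTensor_apply, Fin.succ_ne_zero]

/-- The coupled block `(0,1,1)` contains `C₁` (entrywise, along `mTwo × mOne × mOne`). -/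
@[simp] theorem blk_coupled₁ (p q r : Fin 4) :
    blk (0, 1, 1) (mTwo p) (mOne q) (mOne r) = cpl₁ p q r := by
  rw [blk, partSubtensor_apply, if_pos (by simp)]; rfl

/-- The coupled block `(1,0,1)` contains `C₂`. -/
@[simp] theorem blk_coupled₂ (p q r : Fin 4) :
    blk (1, 0, 1) (mOne p) (mTwo q) (mOne r) = cpl₂ p q r := by
  rw [blk, partSubtensor_apply, if_pos (by simp)]; rfl

/-- The coupled block `(1,1,0)` contains `C₃`. -/
@[simp] theorem blk_coupled₃ (p q r : Fin 4) :
    blk (1, 1, 0) (mOne p) (mOne q) (mTwo r) = cpl₃ p q r := by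
  rw [blk, partSubtensor_apply, if_pos (by simp)]; rfl

/-- Entries of `⟨2,2,2⟩` as a product of three indicators. -/
theorem matMulTensor_two_apply (a b c : Fin 2 × Fin 2) :
    matMulTensor ℂ 2 2 2 a b c =
      (if a.1 = b.1 then 1 else 0) * (if b.2 = c.1 then 1 else 0) * (if a.2 = c.2 then 1 else 0) := by
  rw [ite_zero_mul_ite_zero, ite_zero_mul_ite_zero, mul_one, mul_one,
    show matMulTensor ℂ 2 2 2 a b c = if a.1 = b.1 ∧ b.2 = c.1 ∧ a.2 = c.2 then 1 else 0 from rfl]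
  simp only [and_assoc]

/-! ## 3. The sorted word and the zeroing-out `t^{⊗9N}(w₀) ≥ ⟨2,2,2⟩^{⊠2N} ⊠ C^{⊠2N}` -/

/-- The pattern of one unit of nine coordinates: the three pure blocks once, each coupled block twice. -/
def pattern : Fin 9 → Fin 3 × Fin 3 × Fin 3 :=
  ![(2, 0, 0), (0, 2, 0), (0, 0, 2), (0, 1, 1), (0, 1, 1), (1, 0, 1), (1, 0, 1), (1, 1, 0), (1, 1, 0)]

/-- Letter counts of the pattern. -/
def cnt (s : Fin 3 × Fin 3 × Fin 3) : ℕ := (Finset.univ.filter fun r => pattern r = s).card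

/-- The pattern is supported in `S`. -/
theorem cnt_eq_zero : ∀ s, s ∉ mergedSupport → cnt s = 0 := by decide

/-- The pattern has nine letters. -/
theorem sum_cnt : ∑ s, cnt s = 9 := by
  have h := Finset.card_eq_sum_card_fiberwise (s := (Finset.univ : Finset (Fin 9)))
    (t := (Finset.univ : Finset (Fin 3 × Fin 3 × Fin 3))) (f := pattern) (fun r _ => Finset.mem_univ _)
  simpa [cnt] using h.symm

variable (N : ℕ)

/-- `Fin 9 × Fin N ≃ Fin (9N)` (unit-major layout of the `9N` coordinates). -/
def e₉ : Fin 9 × Fin N ≃ Fin (9 * N) := finProdFinEquiv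

/-- `Fin 2 × Fin N ≃ Fin (2N)` (the two copies per unit of the target's coordinates). -/
def e₂ : Fin 2 × Fin N ≃ Fin (2 * N) := finProdFinEquiv

/-- The sorted word of joint type `N · cnt`. -/
def word : Fin (9 * N) → Fin 3 × Fin 3 × Fin 3 := fun q => pattern ((e₉ N).symm q).1

/-- Index types of `⟨2,2,2⟩^{⊠2N} ⊠ C^{⊠2N}` (all three legs have this shape). -/
abbrev Leg : Type := (Fin (2 * N) → Fin 2 × Fin 2) × (Fin (2 * N) → (Fin 4 × Fin 4) × Fin 4)

/-- x-leg embedding of the indices of `⟨2,2,2⟩^{⊠2N} ⊠ C^{⊠2N}` into the words of the sorted block. -/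
def embX (A : Leg N) : Fin (9 * N) → (Fin 2 → Fin 3) := fun q =>
  let k := ((e₉ N).symm q).2
  (![w00,
     enc (A.1 (e₂ N (0, k))).2 (A.1 (e₂ N (1, k))).2,
     enc (A.1 (e₂ N (0, k))).1 (A.1 (e₂ N (1, k))).1,
     mTwo (A.2 (e₂ N (0, k))).1.1, mTwo (A.2 (e₂ N (1, k))).1.1,
     mOne (A.2 (e₂ N (0, k))).1.2, mOne (A.2 (e₂ N (1, k))).1.2,
     mOne (A.2 (e₂ N (0, k))).2, mOne (A.2 (e₂ N (1, k))).2] : Fin 9 → Fin 2 → Fin 3)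
    ((e₉ N).symm q).1

/-- y-leg embedding. -/
def embY (B : Leg N) : Fin (9 * N) → (Fin 2 → Fin 3) := fun q =>
  let k := ((e₉ N).symm q).2
  (![enc (B.1 (e₂ N (0, k))).2 (B.1 (e₂ N (1, k))).2,
     w00,
     enc (B.1 (e₂ N (0, k))).1 (B.1 (e₂ N (1, k))).1,
     mOne (B.2 (e₂ N (0, k))).1.1, mOne (B.2 (e₂ N (1, k))).1.1,
     mTwo (B.2 (e₂ N (0, k))).1.2, mTwo (B.2 (e₂ N (1, k))).1.2,
     mOne (B.2 (e₂ N (0, k))).2, mOne (B.2 (e₂ N (1, k))).2] : Fin 9 → Fin 2 → Fin 3)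
    ((e₉ N).symm q).1

/-- z-leg embedding. -/
def embZ (C : Leg N) : Fin (9 * N) → (Fin 2 → Fin 3) := fun q =>
  let k := ((e₉ N).symm q).2
  (![enc (C.1 (e₂ N (0, k))).1 (C.1 (e₂ N (1, k))).1,
     enc (C.1 (e₂ N (0, k))).2 (C.1 (e₂ N (1, k))).2,
     w00,
     mOne (C.2 (e₂ N (0, k))).1.1, mOne (C.2 (e₂ N (1, k))).1.1,
     mOne (C.2 (e₂ N (0, k))).1.2, mOne (C.2 (e₂ N (1, k))).1.2,
     mTwo (C.2 (e₂ N (0, k))).2, mTwo (C.2 (e₂ N (1, k))).2] : Fin 9 → Fin 2 → Fin 3)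
    ((e₉ N).symm q).1

/-- The laser block at a label word is the product of the blocks of its letters. -/
theorem laserBlock_eq_prod_blk {M : ℕ} (w : Fin M → Fin 3 × Fin 3 × Fin 3)
    (a b c : Fin M → Fin 2 → Fin 3) :
    laserBlock zc zc zc cwSq w a b c = ∏ q, blk (w q) (a q) (b q) (c q) := rfl

/-- One unit of the sorted block equals two copies of `⟨2,2,2⟩` times two copies of `C`, entrywise. -/
theorem unit_identity (a₀ a₁ b₀ b₁ c₀ c₁ : Fin 2 × Fin 2) (x₀ x₁ y₀ y₁ z₀ z₁ : (Fin 4 × Fin 4) × Fin 4) :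
    blk (2, 0, 0) w00 (enc b₀.2 b₁.2) (enc c₀.1 c₁.1) *
      (blk (0, 2, 0) (enc a₀.2 a₁.2) w00 (enc c₀.2 c₁.2) *
      (blk (0, 0, 2) (enc a₀.1 a₁.1) (enc b₀.1 b₁.1) w00 *
      (blk (0, 1, 1) (mTwo x₀.1.1) (mOne y₀.1.1) (mOne z₀.1.1) *
      (blk (0, 1, 1) (mTwo x₁.1.1) (mOne y₁.1.1) (mOne z₁.1.1) *
      (blk (1, 0, 1) (mOne x₀.1.2) (mTwo y₀.1.2) (mOne z₀.1.2) *
      (blk (1, 0, 1) (mOne x₁.1.2) (mTwo y₁.1.2) (mOne z₁.1.2) *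
      (blk (1, 1, 0) (mOne x₀.2) (mOne y₀.2) (mTwo z₀.2) *
      blk (1, 1, 0) (mOne x₁.2) (mOne y₁.2) (mTwo z₁.2)))))))) =
    (matMulTensor ℂ 2 2 2 a₀ b₀ c₀ * matMulTensor ℂ 2 2 2 a₁ b₁ c₁) *
      (cplTensor x₀ y₀ z₀ * cplTensor x₁ y₁ z₁) := by
  simp only [blk_pure₁, blk_pure₂, blk_pure₃, blk_coupled₁, blk_coupled₂, blk_coupled₃,
    matMulTensor_two_apply, cplTensor, kroneckerTensor_apply]
  ring

/-- **`⟨2,2,2⟩^{⊠2N} ⊠ C^{⊠2N}` is the zero-out of the sorted block along `embX, embY, embZ`.** -/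
theorem laserBlock_emb (A B C : Leg N) :
    laserBlock zc zc zc cwSq (word N) (embX N A) (embY N B) (embZ N C) =
      kroneckerTensor (kroneckerPow (matMulTensor ℂ 2 2 2) (2 * N)) (kroneckerPow cplTensor (2 * N)) A B C := by
  rw [laserBlock_eq_prod_blk, kroneckerTensor_apply, kroneckerPow_apply, kroneckerPow_apply,
    ← (e₉ N).prod_comp, ← (e₂ N).prod_comp, ← (e₂ N).prod_comp, Fintype.prod_prod_type_right,
    Fintype.prod_prod_type_right, Fintype.prod_prod_type_right, ← Finset.prod_mul_distrib]
  refine Finset.prod_congr rfl fun k _ => ?_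
  simp only [word, embX, embY, embZ, Equiv.symm_apply_apply, Fin.prod_univ_succ, Fin.prod_univ_zero,
    Matrix.cons_val_zero, Matrix.cons_val_succ, pattern, mul_one, Fin.succ_zero_eq_one]
  exact unit_identity _ _ _ _ _ _ _ _ _ _ _ _

/-- **The sorted block restricts to `⟨2,2,2⟩^{⊠2N} ⊠ C^{⊠2N}`** (one zeroing-out).
[cite: Blaser2013, Def. 7.2] -/
theorem laserBlock_restrictsTo :
    TensorRestrictsTo (laserBlock zc zc zc cwSq (word N))
      (kroneckerTensor (kroneckerPow (matMulTensor ℂ 2 2 2) (2 * N)) (kroneckerPow cplTensor (2 * N))) := by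
  have h := tensorRestrictsTo_precomp (laserBlock zc zc zc cwSq (word N)) (embX N) (embY N) (embZ N)
  have e : (fun A B C => laserBlock zc zc zc cwSq (word N) (embX N A) (embY N B) (embZ N C)) =
      kroneckerTensor (kroneckerPow (matMulTensor ℂ 2 2 2) (2 * N)) (kroneckerPow cplTensor (2 * N)) := by
    funext A B C; exact laserBlock_emb N A B C
  rwa [e] at h

/-- The letter counts of the sorted word: `N · cnt`. -/
theorem letterCount_word : letterCount (word N) = fun s => N * cnt s := by
  funext s
  rw [letterCount_apply, Finset.card_filter, ← (e₉ N).sum_comp, Fintype.sum_prod_type_right]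
  simp only [word, Equiv.symm_apply_apply, Finset.sum_const, Finset.card_univ, Fintype.card_fin,
    smul_eq_mul]
  rw [cnt, Finset.card_filter]

end Summit.MatrixMultiplication.MatrixMultiplication.Theorems.OutsiderSandwichSquaredLaserBlocks
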